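import Mathlib
import Summits.KontsevichZagierPeriods.Zeta5Search.RayFaceKit
import HarnessLib

/-!
# ζ(5) search — RAY FACE KIT II: soundness — a checked face certificate IS a class-type cover (P1 g14)

HONEST FRAMING: systematic search; no irrationality claim unless certified.  Cell `pub-zeta5`, prover seat P1, generation 14.
Integer bookkeeping of net exponents; every kernel exponent the consumers feed stays `< 1` — no irrationality content; nothing
about `ζ(5)`.

Main theorem `cover_of_faceCheck`: on a ray `b(n)` with block-form net exponents `1 − #{j < J : lo_j n ≤ q ≤ hi_j n} + [2q = B₀ n]`
(`b₀ = B₀ n`), a certificate accepted by `faceCheck B₀ J lo hi c` yields `Cover (b n) p (coverOf J c)` at every `(n, p)` of its window.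
Route: the monotone chain (`G_mono`) locates `2x` in an interval (`jOf_spec`), so every cut is on a known side of `x` (`cut_facts`);
`cross_iff` gives the block indicators of every level (`block_indicator`, `blockSum_eq_depth`), the top cut the last level `Λ`
(`top_facts`), the centre cuts + parity the centre flag and the even-centre term (`cen_facts`, `centre_term`).
-/

namespace Summit.KontsevichZagierPeriods.Zeta5Search.RayFaceKit

open Finset
open Summit.KontsevichZagierPeriods.Zeta5Search.ClusterValuation (netExp CentreIn)
open Summit.KontsevichZagierPeriods.Zeta5Search.ClassTypeCover

/-- The block indicator sum of a ray with lower/upper block coefficients `lo`, `hi`. -/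
def blockSum (J : ℕ) (los his : List ℕ) (n q : ℕ) : ℕ :=
  ∑ j ∈ range J, if los.getD j 0 * n ≤ q ∧ q ≤ his.getD j 0 * n then 1 else 0

/-! ## §1 List bookkeeping -/

/-- Entries of a mapped range. -/
theorem getD_map_range (f : ℕ → ℤ) {L k : ℕ} (hk : k < L) : ((List.range L).map f).getD k 0 = f k := by
  rw [List.getD_eq_getElem _ _ (by simpa using hk)]
  simp

/-- A kind occurring exactly once: its index is in range and carries that kind. -/
theorem idx_spec {cs : List Cut} {κ : Kind} (h : (idxs cs κ).length = 1) :
    idx cs κ < cs.length ∧ (cs.getD (idx cs κ) ⟨.top, 0⟩).kind = κ := by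
  have hne : idxs cs κ ≠ [] := by
    intro h0; rw [h0] at h; simp at h
  obtain ⟨a, l, hal⟩ := List.exists_cons_of_ne_nil hne
  have hidx : idx cs κ = a := by simp [idx, hal]
  have hmem : a ∈ idxs cs κ := by rw [hal]; exact List.mem_cons_self
  simp only [idxs, List.mem_filter, List.mem_range, decide_eq_true_eq] at hmem
  rw [hidx]; exact hmem

/-- Entries of the threshold chain: `0`, the cut thresholds, `2p`. -/
theorem chainList_getD_zero (B0 : ℕ) (los his : List ℕ) (cs : List Cut) :
    (chainList B0 los his cs).getD 0 ⟨0, 0, 0⟩ = ⟨0, 0, 0⟩ := by simp [chainList]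

/-- The middle entries of the chain are the cut thresholds. -/
theorem chainList_getD_succ (B0 : ℕ) (los his : List ℕ) (cs : List Cut) {i : ℕ} (hi : i < cs.length) :
    (chainList B0 los his cs).getD (i + 1) ⟨0, 0, 0⟩ = thr B0 los his cs (cs.getD i ⟨.top, 0⟩) := by
  simp only [chainList, List.getD_cons_succ]
  rw [List.getD_append _ _ _ _ (by simpa using hi), List.getD_eq_getElem _ _ (by simpa using hi),
    List.getD_eq_getElem _ _ hi]
  simp

/-- The last entry of the chain is `2p`. -/
theorem chainList_getD_last (B0 : ℕ) (los his : List ℕ) (cs : List Cut) :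
    (chainList B0 los his cs).getD (cs.length + 1) ⟨0, 0, 0⟩ = ⟨0, 2, 0⟩ := by
  simp only [chainList, List.getD_cons_succ]
  rw [List.getD_append_right _ _ _ _ (by simp)]
  simp

/-- Length of the chain. -/
theorem chainList_length (B0 : ℕ) (los his : List ℕ) (cs : List Cut) :
    (chainList B0 los his cs).length = cs.length + 2 := by simp [chainList]

/-! ## §2 Locating `x` and the side of every cut -/

section Sound

variable {B0 J : ℕ} {los his : List ℕ} {c : FaceCert} {n p x : ℕ}

/-- Values of the chain at `(n, p)`. -/
def G (B0 : ℕ) (los his : List ℕ) (c : FaceCert) (n p i : ℕ) : ℤ :=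
  ((chainList B0 los his c.cuts).getD i ⟨0, 0, 0⟩).eval n p

/-- The interval of `x`: the last chain index `≤ #cuts` whose threshold is `≤ 2x`. -/
def jOf (B0 : ℕ) (los his : List ℕ) (c : FaceCert) (n p x : ℕ) : ℕ :=
  Nat.findGreatest (fun i => G B0 los his c n p i ≤ 2 * (x : ℤ)) c.cuts.length

/-- The chain starts at `0`. -/
theorem G_zero : G B0 los his c n p 0 = 0 := by unfold G; rw [chainList_getD_zero]; simp [Aff.eval]

/-- The chain ends at `2p`. -/
theorem G_last : G B0 los his c n p (c.cuts.length + 1) = 2 * (p : ℤ) := by unfold G; rw [chainList_getD_last]; simp [Aff.eval]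

/-- The chain is monotone at every point of the window. -/
theorem G_mono (hch : c.win.lwedge.chain ((chainList B0 los his c.cuts).map fun f => f.half c.win.r) = true)
    (hm : c.win.Holds n p) {i i' : ℕ} (hii : i ≤ i') (hi' : i' ≤ c.cuts.length + 1) :
    G B0 los his c n p i ≤ G B0 los his c n p i' := by
  obtain ⟨hmem, hn, hp⟩ := Window.holds_lwedge hm
  have hlen := chainList_length B0 los his c.cuts
  have key := LWedge.chain_sound hmem hch i i' hii (by rw [List.length_map, hlen]; omega)
  have hi : i < (chainList B0 los his c.cuts).length := by omega
  have hi'' : i' < (chainList B0 los his c.cuts).length := by omega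
  rw [List.getD_eq_getElem _ _ (by rw [List.length_map]; exact hi),
    List.getD_eq_getElem _ _ (by rw [List.length_map]; exact hi''), List.getElem_map, List.getElem_map] at key
  unfold G
  rw [List.getD_eq_getElem _ _ hi, List.getD_eq_getElem _ _ hi'', Aff.eval_half _ hn hp, Aff.eval_half _ hn hp]
  exact key

/-- `2x` lies in the interval `j = jOf …`: `G j ≤ 2x < G (j+1)`, `j ≤ #cuts`. -/
theorem jOf_spec (hx : x < p) :
    jOf B0 los his c n p x ≤ c.cuts.length ∧ G B0 los his c n p (jOf B0 los his c n p x) ≤ 2 * (x : ℤ) ∧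
      2 * (x : ℤ) < G B0 los his c n p (jOf B0 los his c n p x + 1) := by
  refine ⟨Nat.findGreatest_le _, ?_, ?_⟩
  · have h0 : G B0 los his c n p 0 ≤ 2 * (x : ℤ) := by rw [G_zero]; positivity
    exact Nat.findGreatest_spec (P := fun i => G B0 los his c n p i ≤ 2 * (x : ℤ)) (Nat.zero_le _) h0
  · rcases Nat.lt_or_ge (jOf B0 los his c n p x) c.cuts.length with hlt | hge
    · have := Nat.findGreatest_is_greatest (P := fun i => G B0 los his c n p i ≤ 2 * (x : ℤ))
        (Nat.lt_succ_self _) (by exact hlt)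
      push Not at this; exact this
    · have hj : jOf B0 los his c n p x = c.cuts.length := le_antisymm (Nat.findGreatest_le _) hge
      rw [hj, G_last]; exact_mod_cast Nat.mul_lt_mul_of_pos_left hx (by norm_num)

/-- **Side facts of a cut.** For a kind `κ` occurring once, with cut index `i` and threshold `f`: `0 ≤ f ≤ 2p` at `(n,p)`,
`f ≤ 2x` if interval `j` is past the cut (`i < j`), `2x < f` otherwise. -/
theorem cut_facts (hch : c.win.lwedge.chain ((chainList B0 los his c.cuts).map fun f => f.half c.win.r) = true)
    (hm : c.win.Holds n p) (hx : x < p) {κ : Kind}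
    (hκ : (idxs c.cuts κ).length = 1) :
    0 ≤ (thr B0 los his c.cuts (c.cuts.getD (idx c.cuts κ) ⟨.top, 0⟩)).eval n p ∧
      (thr B0 los his c.cuts (c.cuts.getD (idx c.cuts κ) ⟨.top, 0⟩)).eval n p ≤ 2 * (p : ℤ) ∧
      (idx c.cuts κ < jOf B0 los his c n p x →
        (thr B0 los his c.cuts (c.cuts.getD (idx c.cuts κ) ⟨.top, 0⟩)).eval n p ≤ 2 * (x : ℤ)) ∧
      (jOf B0 los his c n p x ≤ idx c.cuts κ →
        2 * (x : ℤ) < (thr B0 los his c.cuts (c.cuts.getD (idx c.cuts κ) ⟨.top, 0⟩)).eval n p) := by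
  obtain ⟨hi, -⟩ := idx_spec hκ
  obtain ⟨hjle, hGj, hGj1⟩ := jOf_spec (B0 := B0) (los := los) (his := his) (c := c) (n := n) hx
  have hGf : G B0 los his c n p (idx c.cuts κ + 1) =
      (thr B0 los his c.cuts (c.cuts.getD (idx c.cuts κ) ⟨.top, 0⟩)).eval n p := by
    simp only [G, chainList_getD_succ B0 los his c.cuts hi]
  refine ⟨?_, ?_, ?_, ?_⟩
  · rw [← hGf, ← G_zero (B0 := B0) (los := los) (his := his) (c := c) (n := n) (p := p)]
    exact G_mono hch hm (Nat.zero_le _) (by omega)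
  · rw [← hGf, ← G_last (B0 := B0) (los := los) (his := his) (c := c) (n := n) (p := p)]
    exact G_mono hch hm (by omega) le_rfl
  · intro hpast
    rw [← hGf]; exact le_trans (G_mono hch hm (by omega) (by omega)) hGj
  · intro hpast
    rw [← hGf]; exact lt_of_lt_of_le hGj1 (G_mono hch hm (by omega) (by omega))

/-- The side bit of a present kind, as the two implications used with `omega`. -/
theorem pastN_facts (cs : List Cut) (κ : Kind) (j : ℕ) :
    (pastN cs κ j = 1 ↔ idx cs κ < j) ∧ (pastN cs κ j = 0 ↔ j ≤ idx cs κ) := by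
  unfold pastN
  split_ifs with h
  · exact ⟨⟨fun _ => h, fun _ => rfl⟩, ⟨fun h1 => absurd h1 (by norm_num), fun h1 => absurd h (not_lt.2 h1)⟩⟩
  · exact ⟨⟨fun h1 => absurd h1 (by norm_num), fun h1 => absurd h1 h⟩, ⟨fun _ => not_lt.1 h, fun _ => rfl⟩⟩

/-- The side bit times `p`, for `omega`: `t·p ∈ {0, p}` together with the value of `t`. -/
theorem pastN_mul (cs : List Cut) (κ : Kind) (j : ℕ) (p : ℤ) :
    ((pastN cs κ j : ℤ) * p = 0 ∧ pastN cs κ j = 0) ∨ ((pastN cs κ j : ℤ) * p = p ∧ pastN cs κ j = 1) := by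
  rcases (by have := pastN_le_one cs κ j; omega : pastN cs κ j = 0 ∨ pastN cs κ j = 1) with h | h
  · left; simp [h]
  · right; simp [h]

/-! ## §3 The top cut: the last level `Λ` -/
/-- **Top facts**: with `Λ = lam cuts j`, `x + Λp ≤ B₀n < x + Λp + p`. -/
theorem top_facts (hch : c.win.lwedge.chain ((chainList B0 los his c.cuts).map fun f => f.half c.win.r) = true)
    (hm : c.win.Holds n p) (hx : x < p)
    (hκ : (idxs c.cuts .top).length = 1) (hK1 : 1 ≤ levelK c.cuts .top) :
    (x : ℤ) + (lam c.cuts (jOf B0 los his c n p x) : ℕ) * (p : ℤ) ≤ B0 * n ∧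
      (B0 : ℤ) * n < (x : ℤ) + (lam c.cuts (jOf B0 los his c n p x) : ℕ) * (p : ℤ) + p := by
  obtain ⟨h0, h2p, hpa, hnp⟩ := cut_facts hch hm hx hκ
  obtain ⟨-, hkind⟩ := idx_spec hκ
  have hthr : (thr B0 los his c.cuts (c.cuts.getD (idx c.cuts .top) ⟨.top, 0⟩)).eval n p =
      2 * (B0 : ℤ) * n - 2 * (levelK c.cuts .top : ℤ) * p + 2 := by
    simp only [thr, hkind, Aff.eval, levelK]; ring
  rw [hthr] at h0 h2p hpa hnp
  have hxp : (x : ℤ) < p := by exact_mod_cast hx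
  by_cases hp : idx c.cuts .top < jOf B0 los his c n p x
  · have hle := hpa hp
    have hlam : lam c.cuts (jOf B0 los his c n p x) = levelK c.cuts .top - 1 := by simp [lam, pastN, hp]
    rw [hlam, Nat.cast_sub hK1]; push_cast
    constructor <;> nlinarith
  · have hlt := hnp (by omega)
    have hlam : lam c.cuts (jOf B0 los his c n p x) = levelK c.cuts .top := by simp [lam, pastN, hp]
    rw [hlam]
    constructor <;> nlinarith

/-! ## §4 The centre cuts -/
/-- Parity transport: `(a·m) % 2 = (a·s) % 2` when `m % 2 = s`. -/
theorem mul_mod_two_of_mod (a m s : ℕ) (h : m % 2 = s) : (a * m) % 2 = (a * s) % 2 := by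
  subst h
  conv_rhs => rw [Nat.mul_mod, Nat.mod_mod]
  rw [Nat.mul_mod]

/-- **Centre facts**: with `Λ = lam cuts j` and `cen = cenOf cuts j`, `2x + Λp = B₀n` iff `cen`. -/
theorem cen_facts (hch : c.win.lwedge.chain ((chainList B0 los his c.cuts).map fun f => f.half c.win.r) = true)
    (hm : c.win.Holds n p) (hx : x < p)
    (hL : (idxs c.cuts .cenLo).length = 1) (hH : (idxs c.cuts .cenHi).length = 1)
    (hadj : idx c.cuts .cenHi = idx c.cuts .cenLo + 1) (hK1 : 1 ≤ levelK c.cuts .top)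
    (hpar : (B0 * c.win.r + lamC c.cuts) % 2 = 0) :
    (2 * x + lam c.cuts (jOf B0 los his c n p x) * p = B0 * n ↔ cenOf c.cuts (jOf B0 los his c n p x) = true) := by
  obtain ⟨-, -, hLpa, hLnp⟩ := cut_facts hch hm hx hL
  obtain ⟨-, -, hHpa, hHnp⟩ := cut_facts hch hm hx hH
  obtain ⟨-, hkL⟩ := idx_spec hL
  obtain ⟨-, hkH⟩ := idx_spec hH
  have hthrL : (thr B0 los his c.cuts (c.cuts.getD (idx c.cuts .cenLo) ⟨.top, 0⟩)).eval n p =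
      (B0 : ℤ) * n - (lamC c.cuts : ℤ) * p := by
    simp only [thr, hkL, Aff.eval]; ring
  have hthrH : (thr B0 los his c.cuts (c.cuts.getD (idx c.cuts .cenHi) ⟨.top, 0⟩)).eval n p =
      (B0 : ℤ) * n - (lamC c.cuts : ℤ) * p + 2 := by
    simp only [thr, hkH, Aff.eval]; ring
  rw [hthrL] at hLpa hLnp
  rw [hthrH] at hHpa hHnp
  rw [hadj] at hHpa hHnp
  -- the centre flag is the position `iL < j ≤ iL + 1`
  have hcen_iff : cenOf c.cuts (jOf B0 los his c n p x) = true ↔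
      idx c.cuts .cenLo < jOf B0 los his c n p x ∧ jOf B0 los his c n p x ≤ idx c.cuts .cenLo + 1 := by
    simp only [cenOf, hadj, Bool.and_eq_true, decide_eq_true_eq, Bool.not_eq_eq_eq_not, Bool.not_true,
      decide_eq_false_iff_not, not_lt]
  rw [hcen_iff]
  -- integer bookkeeping: `Λ = KT − t₁`, `L_c = KT − t₂` with side bits `t₁, t₂ ∈ {0,1}`
  have ht1 := pastN_le_one c.cuts .top (jOf B0 los his c n p x)
  have ht2 := pastN_le_one c.cuts .top (idx c.cuts .cenLo + 1)
  have hΛz : ((lam c.cuts (jOf B0 los his c n p x) : ℕ) : ℤ) =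
      (levelK c.cuts .top : ℤ) - (pastN c.cuts .top (jOf B0 los his c n p x) : ℤ) := by
    simp only [lam]; rw [Nat.cast_sub (le_trans ht1 hK1)]
  have hLcz : ((lamC c.cuts : ℕ) : ℤ) = (levelK c.cuts .top : ℤ) - (pastN c.cuts .top (idx c.cuts .cenLo + 1) : ℤ) := by
    simp only [lamC, lam]; rw [Nat.cast_sub (le_trans ht2 hK1)]
  have hΛp : ((lam c.cuts (jOf B0 los his c n p x) : ℕ) : ℤ) * p =
      (levelK c.cuts .top : ℤ) * p - (pastN c.cuts .top (jOf B0 los his c n p x) : ℤ) * p := by rw [hΛz]; ring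
  have hLcp : ((lamC c.cuts : ℕ) : ℤ) * p =
      (levelK c.cuts .top : ℤ) * p - (pastN c.cuts .top (idx c.cuts .cenLo + 1) : ℤ) * p := by rw [hLcz]; ring
  have hm1 := pastN_mul c.cuts .top (jOf B0 los his c n p x) (p : ℤ)
  have hm2 := pastN_mul c.cuts .top (idx c.cuts .cenLo + 1) (p : ℤ)
  obtain ⟨hP1a, hP1b⟩ := pastN_facts c.cuts .top (jOf B0 los his c n p x)
  obtain ⟨hP2a, hP2b⟩ := pastN_facts c.cuts .top (idx c.cuts .cenLo + 1)
  -- parity facts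
  have hr : n % 2 = c.win.r := hm.2.2.2.1
  have hp2 : p % 2 = 1 := hm.2.2.2.2
  have hBn : (B0 * n) % 2 = (B0 * c.win.r) % 2 := mul_mod_two_of_mod B0 n c.win.r hr
  have hQ : (levelK c.cuts .top * p) % 2 = (levelK c.cuts .top * 1) % 2 := mul_mod_two_of_mod _ p 1 hp2
  rw [mul_one] at hQ
  zify at hBn hQ hpar hp2
  have hxz : (x : ℤ) < p := by exact_mod_cast hx
  constructor
  · intro heq
    have heq' : 2 * (x : ℤ) + ((lam c.cuts (jOf B0 los his c n p x) : ℕ) : ℤ) * p = (B0 : ℤ) * n := by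
      exact_mod_cast heq
    by_cases h1 : idx c.cuts .cenLo < jOf B0 los his c n p x
    · by_cases h2 : idx c.cuts .cenLo + 1 < jOf B0 los his c n p x
      · have hle := hHpa h2
        exfalso
        rcases hm1 with ⟨hm1, ht1v⟩ | ⟨hm1, ht1v⟩ <;> rcases hm2 with ⟨hm2, ht2v⟩ | ⟨hm2, ht2v⟩ <;> omega
      · exact ⟨h1, not_lt.1 h2⟩
    · have hlt := hLnp (not_lt.1 h1)
      exfalso
      rcases hm1 with ⟨hm1, ht1v⟩ | ⟨hm1, ht1v⟩ <;> rcases hm2 with ⟨hm2, ht2v⟩ | ⟨hm2, ht2v⟩ <;> omega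
  · rintro ⟨h1, h2⟩
    have hle := hLpa h1
    have hlt := hHnp h2
    have hΛL : lam c.cuts (jOf B0 los his c n p x) = lamC c.cuts := by
      have hj : jOf B0 los his c n p x = idx c.cuts .cenLo + 1 := by omega
      rw [lamC, ← hj]
    have hgoal : 2 * (x : ℤ) + ((lam c.cuts (jOf B0 los his c n p x) : ℕ) : ℤ) * p = (B0 : ℤ) * n := by
      rw [hΛL]; omega
    exact_mod_cast hgoal

/-! ## §5 Blocks: the depth of every level -/
/-- One block: its indicator at level `k` of interval `j` is `blockOn`. -/
theorem block_indicator (hch : c.win.lwedge.chain ((chainList B0 los his c.cuts).map fun f => f.half c.win.r) = true)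
    (hm : c.win.Holds n p) (hx : x < p)
    {jb : ℕ} (hlo : (idxs c.cuts (.lo jb)).length = 1) (hhi : (idxs c.cuts (.hi jb)).length = 1) (k : ℕ) :
    (los.getD jb 0 * n ≤ x + k * p ∧ x + k * p ≤ his.getD jb 0 * n) ↔
      blockOn c.cuts (jOf B0 los his c n p x) jb k = true := by
  obtain ⟨h0l, h2l, hlpa, hlnp⟩ := cut_facts hch hm hx hlo
  obtain ⟨h0h, h2h, hhpa, hhnp⟩ := cut_facts hch hm hx hhi
  obtain ⟨-, hkl⟩ := idx_spec hlo
  obtain ⟨-, hkh⟩ := idx_spec hhi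
  have hthrl : (thr B0 los his c.cuts (c.cuts.getD (idx c.cuts (.lo jb)) ⟨.top, 0⟩)).eval n p =
      2 * ((los.getD jb 0 : ℤ) * n - ((levelK c.cuts (.lo jb) : ℤ) - 1) * p) := by
    simp only [thr, hkl, Aff.eval, levelK]; ring
  have hthrh : (thr B0 los his c.cuts (c.cuts.getD (idx c.cuts (.hi jb)) ⟨.top, 0⟩)).eval n p =
      2 * (((his.getD jb 0 : ℤ) * n + 1) - ((levelK c.cuts (.hi jb) : ℤ) - 1) * p) := by
    simp only [thr, hkh, Aff.eval, levelK]; ring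
  rw [hthrl] at h0l h2l hlpa hlnp
  rw [hthrh] at h0h h2h hhpa hhnp
  obtain ⟨hla, hlb⟩ := pastN_facts c.cuts (.lo jb) (jOf B0 los his c n p x)
  obtain ⟨hha, hhb⟩ := pastN_facts c.cuts (.hi jb) (jOf B0 los his c n p x)
  -- crossing lemma for the lower end (`m = lo n`) and the upper end (`m = hi n + 1`)
  have hxz : (x : ℤ) < p := by exact_mod_cast hx
  have cl := cross_iff (m := (los.getD jb 0 : ℤ) * n) (x := (x : ℤ)) (p := (p : ℤ)) (K := levelK c.cuts (.lo jb))
    (k := k) (s := pastN c.cuts (.lo jb) (jOf B0 los his c n p x))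
    (c := (los.getD jb 0 : ℤ) * n - ((levelK c.cuts (.lo jb) : ℤ) - 1) * p) rfl (by linarith) (by linarith)
    (by positivity) hxz (pastN_le_one _ _ _)
    (fun hs => by have := hlpa (hla.1 hs); linarith) (fun hs => by have := hlnp (hlb.1 hs); linarith)
  have ch := cross_iff (m := (his.getD jb 0 : ℤ) * n + 1) (x := (x : ℤ)) (p := (p : ℤ))
    (K := levelK c.cuts (.hi jb)) (k := k) (s := pastN c.cuts (.hi jb) (jOf B0 los his c n p x))
    (c := ((his.getD jb 0 : ℤ) * n + 1) - ((levelK c.cuts (.hi jb) : ℤ) - 1) * p) rfl (by linarith) (by linarith)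
    (by positivity) hxz (pastN_le_one _ _ _)
    (fun hs => by have := hhpa (hha.1 hs); linarith) (fun hs => by have := hhnp (hhb.1 hs); linarith)
  have e1 : (los.getD jb 0 * n ≤ x + k * p) ↔ ((los.getD jb 0 : ℤ) * n ≤ x + k * p) := by
    constructor
    · intro h; exact_mod_cast h
    · intro h; exact_mod_cast h
  have e2 : (x + k * p ≤ his.getD jb 0 * n) ↔ ¬ ((his.getD jb 0 : ℤ) * n + 1 ≤ x + k * p) := by
    constructor
    · intro h h'; have h'' : (x : ℤ) + k * p ≤ his.getD jb 0 * n := by exact_mod_cast h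
      linarith
    · intro h; push Not at h
      have : (x : ℤ) + k * p ≤ his.getD jb 0 * n := by linarith
      exact_mod_cast this
  rw [e1, e2, cl, ch]
  simp only [blockOn, Bool.and_eq_true, decide_eq_true_eq, Bool.not_eq_eq_eq_not, Bool.not_true,
    decide_eq_false_iff_not]
  constructor
  · rintro ⟨h1, h2⟩; exact ⟨by exact_mod_cast h1, fun h => h2 (by exact_mod_cast h)⟩
  · rintro ⟨h1, h2⟩; exact ⟨by exact_mod_cast h1, fun h => h2 (by exact_mod_cast h)⟩

/-- The block sum of every level equals the computed `depth`. -/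
theorem blockSum_eq_depth (hch : c.win.lwedge.chain ((chainList B0 los his c.cuts).map fun f => f.half c.win.r) = true)
    (hm : c.win.Holds n p) (hx : x < p)
    (hkinds : ∀ jb, jb < J → (idxs c.cuts (.lo jb)).length = 1 ∧ (idxs c.cuts (.hi jb)).length = 1) (k : ℕ) :
    ∀ J', J' ≤ J → blockSum J' los his n (x + k * p) = depth c.cuts (jOf B0 los his c n p x) k J'
  | 0, _ => by simp [blockSum, depth]
  | J' + 1, hJ' => by
      have ih := blockSum_eq_depth hch hm hx hkinds k J' (by omega)
      simp only [blockSum, sum_range_succ] at ih ⊢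
      rw [ih, depth]
      obtain ⟨hlo, hhi⟩ := hkinds J' (by omega)
      by_cases hb : blockOn c.cuts (jOf B0 los his c n p x) J' k = true
      · rw [if_pos ((block_indicator hch hm hx hlo hhi k).2 hb), if_pos hb]
      · rw [if_neg (fun h => hb ((block_indicator hch hm hx hlo hhi k).1 h)), if_neg hb]

/-! ## §6 The even-centre term and the assembly -/
/-- Off the centre class no level is the centre: a centre level forces `2x + Λp = B₀n`. -/
theorem centre_term {Λ : ℕ} (hL : (x : ℤ) + (Λ : ℤ) * p ≤ B0 * n) (hL' : (B0 : ℤ) * n < x + (Λ : ℤ) * p + p)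
    (hx : x < p) (k : ℕ) (h : 2 * (x + k * p) = B0 * n) : 2 * x + Λ * p = B0 * n := by
  have hp0 : (0 : ℤ) < p := by exact_mod_cast (show 0 < p by omega)
  have h0 : 2 * x + 2 * k * p = B0 * n := by rw [← h]; ring
  have h' : 2 * (x : ℤ) + 2 * (k : ℤ) * p = B0 * n := by exact_mod_cast h0
  have hxp : (x : ℤ) < p := by exact_mod_cast hx
  have h1 : (Λ : ℤ) * p < (2 * k + 1) * p := by nlinarith
  have h2 : 2 * (k : ℤ) * p < ((Λ : ℤ) + 1) * p := by nlinarith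
  have h3 : (Λ : ℤ) < 2 * k + 1 := lt_of_mul_lt_mul_right h1 hp0.le
  have h4 : 2 * (k : ℤ) < Λ + 1 := lt_of_mul_lt_mul_right h2 hp0.le
  have h5 : (Λ : ℤ) = 2 * k := by omega
  have h6 : Λ = 2 * k := by exact_mod_cast h5
  rw [h6, ← h]; ring

/-- **SOUNDNESS OF THE FACE CHECKER.**  On a ray `b(n)` with block-form net exponents and `b₀ = B₀n`, a certificate accepted by
`faceCheck` gives, at every `(n, p)` of its window, the class-type cover `coverOf J c`. -/
theorem cover_of_faceCheck {b : ℕ → ℕ → ℤ} (hb0 : ∀ n, b n 0 = ((B0 * n : ℕ) : ℤ))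
    (hnet : ∀ n q, netExp (b n) q = 1 - (blockSum J los his n q : ℤ) + if 2 * q = B0 * n then 1 else 0)
    (hc : faceCheck B0 J los his c = true) [Fact p.Prime] (hm : c.win.Holds n p) :
    Cover (b n) p (coverOf J c) := by
  simp only [faceCheck, kindsOK, Bool.and_eq_true, decide_eq_true_eq, List.all_eq_true, List.mem_range] at hc
  obtain ⟨⟨⟨⟨⟨⟨⟨⟨hT, hL⟩, hH⟩, hblocks⟩, hadj⟩, hK1⟩, hpar⟩, -⟩, hch⟩ := hc
  intro x hx
  have hp0 : 0 < p := by omega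
  set j := jOf B0 los his c n p x with hjdef
  obtain ⟨hjle, -, -⟩ := jOf_spec (B0 := B0) (los := los) (his := his) (c := c) (n := n) hx
  refine ⟨(word J c.cuts j, cenOf c.cuts j), List.mem_map.2 ⟨j, List.mem_range.2 (by omega), rfl⟩, ?_⟩
  -- the last level and the centre
  obtain ⟨hLe, hLt⟩ := top_facts hch hm hx hT hK1
  have hcen := cen_facts hch hm hx hL hH hadj hK1 hpar
  set Λ := lam c.cuts j with hΛdef
  have hb0n : (b n 0).toNat = B0 * n := by rw [hb0]; exact Int.toNat_natCast _
  have h0 : 0 ≤ b n 0 := by rw [hb0]; positivity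
  have hlen : (word J c.cuts j).length = Λ + 1 := by simp [word, hΛdef]
  have hLe' : x + Λ * p ≤ (b n 0).toNat := by rw [hb0n]; exact_mod_cast hLe
  have hLt' : (b n 0).toNat < x + Λ * p + p := by rw [hb0n]; exact_mod_cast hLt
  -- the levels
  have hlev : Levels (b n) x p (word J c.cuts j) := by
    intro k hk
    rw [hlen] at hk
    simp only [word]
    rw [getD_map_range _ hk, hnet, entry, blockSum_eq_depth hch hm hx hblocks k J le_rfl]
    congr 1
    by_cases hck : cenOf c.cuts j = true
    · have heq := hcen.2 hck
      have hiff : 2 * (x + k * p) = B0 * n ↔ 2 * k = Λ := by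
        constructor
        · intro h
          have h1 : 2 * x + 2 * k * p = 2 * x + Λ * p := by rw [heq, ← h]; ring
          have h2 : 2 * k * p = Λ * p := by omega
          exact Nat.eq_of_mul_eq_mul_right hp0 h2
        · intro h; rw [← heq, ← h]; ring
      simp [hck, hiff, hΛdef]
    · have hne : ¬ 2 * (x + k * p) = B0 * n := fun h => hck (hcen.1 (centre_term hLe hLt hx k h))
      simp [hck, hne]
  -- assemble
  by_cases hck : cenOf c.cuts j = true
  · rw [hck]
    exact isType_of_eq h0 Λ hlen hx hLe' hLt' hlev (by rw [hb0n]; exact hcen.2 hck)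
  · rw [Bool.eq_false_iff.2 hck]
    exact isType_of_ne h0 Λ hlen hx hLe' hLt' hlev (by rw [hb0n]; exact fun h => hck (hcen.1 h))

end Sound

end Summit.KontsevichZagierPeriods.Zeta5Search.RayFaceKit
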